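import Summits.QuantumAdvantage.QuantumAdvantage.Theorems.CubicForrelationNearExactIsExactCubicFormR4ZLeafEval

/-!
# Crux `CubicForrelation.NearExactIsExact` (stmt-QuantumAdvantage-14043) — E1280-even, R4 branch, the d-level leaf of descendant `0`:
  ENTRIES OF THE TRANSPORTED CUBIC FORM in the adapted frame

Certificate seat `b2b-cforr-cert` (gen 43).  HONEST FRAMING: kernel-checked bookkeeping (standard axioms), tool 4 for the leaf statement
`HLEAF` of …CubicFormR4ZReduce.  The frame: columns `y' = y`, `v'_i = β_i y + b_i` (`b_i` = column `i` of the symplectic `v`-frame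
`BC`, …CubicFormR4ZLeafSp), `z'_s = ε_s y + r_s` (`r_s` = column `s` of the `z`-frame `RC`, …CubicFormR4ZLeafXi), with the shears
`ε_s = E(r_s)` and `β` chosen by `tq5_beta_exists` (the Lefschetz map `β ↦ β ∧ ω` is onto `Λ³(𝔽₂⁴)*`).  RESULTS: the ten block entries
`tq5_e_*` of `d'_{φjk} = Σ P_ψφ P_aj P_bk d_ψab` via …CubicFormR4ZLeafEval `tq5_eval`: `d'(y,v'_i,v'_i') = ω_ii'`,
`d'(v'_i,z'_s,z'_u) = a(b_i)(Rᵀ Ξ R)_su`, `d'(v'_i,v'_i',z'_s) = a(b_i)Y_i'(s) + a(b_i')Y_i(s)` (`Y_i(s) = Σ M_tj (b_i)_t (r_s)_j`), all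
other blocks `0` — the normal form `y∧ω + v₀∧(Ξ' + Σ v_t∧Y_t)` of …TwelvePartnerR4LeafZ.  Nothing about `θ₁₂`; NOT summit progress.

References: this seat lineage (g39 HANDPROOFS §2.4, g43 LEAN-GEN43).  Axioms: the standard three.
-/

set_option linter.dupNamespace false -- D-0017: single-problem summit ⇒ `QuantumAdvantage.QuantumAdvantage` by design

namespace Summit.QuantumAdvantage.QuantumAdvantage.Theorems.CubicForrelation.NearExactIsExact

open Finset

/-- **The `y`-shear exists**: a symmetric `3`-tensor `q` on `𝔽₂⁴` with zero diagonals is `β ∧ ω` for `ω = v₀∧v₁ + v₂∧v₃` and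
`β = (q₀₂₃, q₁₂₃, q₀₁₂, q₀₁₃)`. [folklore] -/
theorem tq5_beta_exists (q : Fin 4 → Fin 4 → Fin 4 → ZMod 2) (hqs : ∀ i j k, q i k j = q i j k) (hqc : ∀ i j k, q j i k = q i j k)
    (hqd : ∀ i j, q i j j = 0) :
    ∃ β : Fin 4 → ZMod 2, ∀ i i' i'' : Fin 4,
      q i i' i'' + β i * ((if (i' = 0 ∧ i'' = 1) ∨ (i' = 1 ∧ i'' = 0) then (1 : ZMod 2) else 0) + (if (i' = 2 ∧ i'' = 3) ∨ (i' = 3 ∧ i'' = 2) then (1 : ZMod 2) else 0)) + β i' * ((if (i = 0 ∧ i'' = 1) ∨ (i = 1 ∧ i'' = 0) then (1 : ZMod 2) else 0) + (if (i = 2 ∧ i'' = 3) ∨ (i = 3 ∧ i'' = 2) then (1 : ZMod 2) else 0)) + β i'' * ((if (i = 0 ∧ i' = 1) ∨ (i = 1 ∧ i' = 0) then (1 : ZMod 2) else 0) + (if (i = 2 ∧ i' = 3) ∨ (i = 3 ∧ i' = 2) then (1 : ZMod 2) else 0)) = 0 := by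
  have h4 : ∀ t : Fin 4, t = 0 ∨ t = 1 ∨ t = 2 ∨ t = 3 := by decide
  have hqd2 : ∀ i j, q j i j = 0 := fun i j => by rw [hqc]; exact hqd i j
  have hqd3 : ∀ i j, q j j i = 0 := fun i j => by rw [hqs]; exact hqd2 i j
  have hrep : ∀ i i' i'' : Fin 4, q i i' i'' =
      (if ((i = 0 ∧ i' = 1 ∧ i'' = 2) ∨ (i = 0 ∧ i' = 2 ∧ i'' = 1) ∨ (i = 1 ∧ i' = 0 ∧ i'' = 2) ∨ (i = 1 ∧ i' = 2 ∧ i'' = 0) ∨ (i = 2 ∧ i' = 0 ∧ i'' = 1) ∨ (i = 2 ∧ i' = 1 ∧ i'' = 0)) then q 0 1 2 else 0) + (if ((i = 0 ∧ i' = 1 ∧ i'' = 3) ∨ (i = 0 ∧ i' = 3 ∧ i'' = 1) ∨ (i = 1 ∧ i' = 0 ∧ i'' = 3) ∨ (i = 1 ∧ i' = 3 ∧ i'' = 0) ∨ (i = 3 ∧ i' = 0 ∧ i'' = 1) ∨ (i = 3 ∧ i' = 1 ∧ i'' = 0)) then q 0 1 3 else 0) + (if ((i = 0 ∧ i' = 2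 ∧ i'' = 3) ∨ (i = 0 ∧ i' = 3 ∧ i'' = 2) ∨ (i = 2 ∧ i' = 0 ∧ i'' = 3) ∨ (i = 2 ∧ i' = 3 ∧ i'' = 0) ∨ (i = 3 ∧ i' = 0 ∧ i'' = 2) ∨ (i = 3 ∧ i' = 2 ∧ i'' = 0)) then q 0 2 3 else 0) + (if ((i = 1 ∧ i' = 2 ∧ i'' = 3) ∨ (i = 1 ∧ i' = 3 ∧ i'' = 2) ∨ (i = 2 ∧ i' = 1 ∧ i'' = 3) ∨ (i = 2 ∧ i' = 3 ∧ i'' = 1) ∨ (i = 3 ∧ i' = 1 ∧ i'' = 2) ∨ (i = 3 ∧ i' = 2 ∧ i'' = 1)) then q 1 2 3 else 0) := by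
    intro i i' i''
    rcases h4 i with rfl | rfl | rfl | rfl <;> rcases h4 i' with rfl | rfl | rfl | rfl <;> rcases h4 i'' with rfl | rfl | rfl | rfl
    · rw [hqd 0 0]; simp
    · rw [hqd3 1 0]; simp
    · rw [hqd3 2 0]; simp
    · rw [hqd3 3 0]; simp
    · rw [hqd2 1 0]; simp
    · rw [hqd 0 1]; simp
    · simp
    · simp
    · rw [hqd2 2 0]; simp
    · rw [hqs 0 1 2]; simp
    · rw [hqd 0 2]; simp
    · simp
    · rw [hqd2 3 0]; simp
    · rw [hqs 0 1 3]; simp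
    · rw [hqs 0 2 3]; simp
    · rw [hqd 0 3]; simp
    · rw [hqd 1 0]; simp
    · rw [hqd2 0 1]; simp
    · rw [hqc 0 1 2]; simp
    · rw [hqc 0 1 3]; simp
    · rw [hqd3 0 1]; simp
    · rw [hqd 1 1]; simp
    · rw [hqd3 2 1]; simp
    · rw [hqd3 3 1]; simp
    · rw [hqs 1 0 2, hqc 0 1 2]; simp
    · rw [hqd2 2 1]; simp
    · rw [hqd 1 2]; simp
    · simp
    · rw [hqs 1 0 3, hqc 0 1 3]; simp
    · rw [hqd2 3 1]; simp
    · rw [hqs 1 2 3]; simp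
    · rw [hqd 1 3]; simp
    · rw [hqd 2 0]; simp
    · rw [hqc 0 2 1, hqs 0 1 2]; simp
    · rw [hqd2 0 2]; simp
    · rw [hqc 0 2 3]; simp
    · rw [hqc 1 2 0, hqs 1 0 2, hqc 0 1 2]; simp
    · rw [hqd 2 1]; simp
    · rw [hqd2 1 2]; simp
    · rw [hqc 1 2 3]; simp
    · rw [hqd3 0 2]; simp
    · rw [hqd3 1 2]; simp
    · rw [hqd 2 2]; simp
    · rw [hqd3 3 2]; simp
    · rw [hqs 2 0 3, hqc 0 2 3]; simp
    · rw [hqs 2 1 3, hqc 1 2 3]; simp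
    · rw [hqd2 3 2]; simp
    · rw [hqd 2 3]; simp
    · rw [hqd 3 0]; simp
    · rw [hqc 0 3 1, hqs 0 1 3]; simp
    · rw [hqc 0 3 2, hqs 0 2 3]; simp
    · rw [hqd2 0 3]; simp
    · rw [hqc 1 3 0, hqs 1 0 3, hqc 0 1 3]; simp
    · rw [hqd 3 1]; simp
    · rw [hqc 1 3 2, hqs 1 2 3]; simp
    · rw [hqd2 1 3]; simp
    · rw [hqc 2 3 0, hqs 2 0 3, hqc 0 2 3]; simp
    · rw [hqc 2 3 1, hqs 2 1 3, hqc 1 2 3]; simp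
    · rw [hqd 3 2]; simp
    · rw [hqd2 2 3]; simp
    · rw [hqd3 0 3]; simp
    · rw [hqd3 1 3]; simp
    · rw [hqd3 2 3]; simp
    · rw [hqd 3 3]; simp
  refine ⟨(fun i : Fin 4 => if i = 0 then q 0 2 3 else if i = 1 then q 1 2 3 else if i = 2 then q 0 1 2 else q 0 1 3), fun i i' i'' => ?_⟩
  rw [hrep i i' i'']
  generalize q 0 1 2 = x1
  generalize q 0 1 3 = x2
  generalize q 0 2 3 = x3
  generalize q 1 2 3 = x4
  revert i i' i'' x1 x2 x3 x4
  decide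

section Frame

variable (d : Fin (5 + 7) → Fin (5 + 7) → Fin (5 + 7) → ZMod 2) (hds : ∀ φ j k, d φ k j = d φ j k) (hdc : ∀ φ j k, d j φ k = d φ j k) (hdd : ∀ φ j, d φ j j = 0)
  (hF : ∀ j k, d (Fin.castAdd 7 (0 : Fin 5)) j k =
      (if (j = Fin.castAdd 7 (1 : Fin 5) ∧ k = Fin.castAdd 7 (2 : Fin 5)) ∨ (j = Fin.castAdd 7 (2 : Fin 5) ∧ k = Fin.castAdd 7 (1 : Fin 5)) then 1 else 0) +
      (if (j = Fin.castAdd 7 (3 : Fin 5) ∧ k = Fin.castAdd 7 (4 : Fin 5)) ∨ (j = Fin.castAdd 7 (4 : Fin 5) ∧ k = Fin.castAdd 7 (3 : Fin 5)) then 1 else 0))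
  (hzzz : ∀ σ τ υ : Fin 7, d (Fin.natAdd 5 σ) (Fin.natAdd 5 τ) (Fin.natAdd 5 υ) = 0) (a : Fin 4 → ZMod 2) (Ξ : Fin 7 → Fin 7 → ZMod 2)
  (hdΞ : ∀ (t : Fin 4) (j k : Fin 7), d (Fin.castAdd 7 t.succ) (Fin.natAdd 5 j) (Fin.natAdd 5 k) = a t * Ξ j k)
  (E : Fin 7 → ZMod 2) (M : Fin 4 → Fin 7 → ZMod 2)
  (hdL : ∀ (t t' : Fin 4) (j : Fin 7), d (Fin.castAdd 7 t.succ) (Fin.castAdd 7 t'.succ) (Fin.natAdd 5 j) =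
      ((if (t = 0 ∧ t' = 1) ∨ (t = 1 ∧ t' = 0) then (1 : ZMod 2) else 0) + (if (t = 2 ∧ t' = 3) ∨ (t = 3 ∧ t' = 2) then (1 : ZMod 2) else 0)) * E j + a t * M t' j + a t' * M t j)
  (BC : Fin 4 → Fin 4 → ZMod 2) (RC : Fin 7 → Fin 7 → ZMod 2) (β : Fin 4 → ZMod 2) (ε : Fin 7 → ZMod 2)
  (P : Fin (5 + 7) → Fin (5 + 7) → ZMod 2)
include hds hdc hdd hF hzzz hdΞ hdL

/-- `d'(y,y,y) = 0`. [this work] -/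
theorem tq5_e_yyy 
    (hP0 : ∀ ψ, P ψ (Fin.castAdd 7 (0 : Fin 5)) = (Fin.append (Fin.cons (1) ((0 : Fin 4 → ZMod 2)) : Fin 5 → ZMod 2) ((0 : Fin 7 → ZMod 2)) : Fin (5 + 7) → ZMod 2) ψ) :
    (∑ ψ, ∑ α, ∑ β', P ψ (Fin.castAdd 7 (0 : Fin 5)) * P α (Fin.castAdd 7 (0 : Fin 5)) * P β' (Fin.castAdd 7 (0 : Fin 5)) * d ψ α β') =
      0 := by
  simp only [hP0]
  rw [tq5_eval d hds hdc hdd hF hzzz a Ξ hdΞ E M hdL]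
  simp only [Pi.zero_apply, mul_zero, zero_mul, sum_const_zero, add_zero]


/-- `d'(y,y,v'_i) = 0`. [this work] -/
theorem tq5_e_yyv (i : Fin 4)
    (hP0 : ∀ ψ, P ψ (Fin.castAdd 7 (0 : Fin 5)) = (Fin.append (Fin.cons (1) ((0 : Fin 4 → ZMod 2)) : Fin 5 → ZMod 2) ((0 : Fin 7 → ZMod 2)) : Fin (5 + 7) → ZMod 2) ψ)
    (hPv : ∀ ψ (i : Fin 4), P ψ (Fin.castAdd 7 (Fin.succ i)) = (Fin.append (Fin.cons (β i) (BC i) : Fin 5 → ZMod 2) ((0 : Fin 7 → ZMod 2)) : Fin (5 + 7) → ZMod 2) ψ) :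
    (∑ ψ, ∑ α, ∑ β', P ψ (Fin.castAdd 7 (0 : Fin 5)) * P α (Fin.castAdd 7 (0 : Fin 5)) * P β' (Fin.castAdd 7 (Fin.succ i)) * d ψ α β') =
      0 := by
  simp only [hP0, hPv]
  rw [tq5_eval d hds hdc hdd hF hzzz a Ξ hdΞ E M hdL]
  simp only [Pi.zero_apply, mul_zero, zero_mul, sum_const_zero, add_zero]


/-- `d'(y,y,z'_s) = 0`. [this work] -/
theorem tq5_e_yyz (s : Fin 7)
    (hP0 : ∀ ψ, P ψ (Fin.castAdd 7 (0 : Fin 5)) = (Fin.append (Fin.cons (1) ((0 : Fin 4 → ZMod 2)) : Fin 5 → ZMod 2) ((0 : Fin 7 → ZMod 2)) : Fin (5 + 7) → ZMod 2) ψ)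
    (hPz : ∀ ψ (j : Fin 7), P ψ (Fin.natAdd 5 j) = (Fin.append (Fin.cons (ε j) ((0 : Fin 4 → ZMod 2)) : Fin 5 → ZMod 2) (RC j) : Fin (5 + 7) → ZMod 2) ψ) :
    (∑ ψ, ∑ α, ∑ β', P ψ (Fin.castAdd 7 (0 : Fin 5)) * P α (Fin.castAdd 7 (0 : Fin 5)) * P β' (Fin.natAdd 5 s) * d ψ α β') =
      0 := by
  simp only [hP0, hPz]
  rw [tq5_eval d hds hdc hdd hF hzzz a Ξ hdΞ E M hdL]
  simp only [Pi.zero_apply, mul_zero, zero_mul, sum_const_zero, add_zero]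


/-- `d'(y,v'_i,v'_i') = ω_{ii'}` (the frame is symplectic). [this work] -/
theorem tq5_e_yvv (i i' : Fin 4)
    (hP0 : ∀ ψ, P ψ (Fin.castAdd 7 (0 : Fin 5)) = (Fin.append (Fin.cons (1) ((0 : Fin 4 → ZMod 2)) : Fin 5 → ZMod 2) ((0 : Fin 7 → ZMod 2)) : Fin (5 + 7) → ZMod 2) ψ)
    (hPv : ∀ ψ (i : Fin 4), P ψ (Fin.castAdd 7 (Fin.succ i)) = (Fin.append (Fin.cons (β i) (BC i) : Fin 5 → ZMod 2) ((0 : Fin 7 → ZMod 2)) : Fin (5 + 7) → ZMod 2) ψ)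
    (hBω : ∀ i i' : Fin 4, (∑ t : Fin 4, ∑ t' : Fin 4, BC i t * BC i' t' * ((if (t = 0 ∧ t' = 1) ∨ (t = 1 ∧ t' = 0) then (1 : ZMod 2) else 0) + (if (t = 2 ∧ t' = 3) ∨ (t = 3 ∧ t' = 2) then (1 : ZMod 2) else 0))) = ((if (i = 0 ∧ i' = 1) ∨ (i = 1 ∧ i' = 0) then (1 : ZMod 2) else 0) + (if (i = 2 ∧ i' = 3) ∨ (i = 3 ∧ i' = 2) then (1 : ZMod 2) else 0))) :
    (∑ ψ, ∑ α, ∑ β', P ψ (Fin.castAdd 7 (0 : Fin 5)) * P α (Fin.castAdd 7 (Fin.succ i)) * P β' (Fin.castAdd 7 (Fin.succ i')) * d ψ α β') =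
      ((if (i = 0 ∧ i' = 1) ∨ (i = 1 ∧ i' = 0) then (1 : ZMod 2) else 0) + (if (i = 2 ∧ i' = 3) ∨ (i = 3 ∧ i' = 2) then (1 : ZMod 2) else 0)) := by
  simp only [hP0, hPv]
  rw [tq5_eval d hds hdc hdd hF hzzz a Ξ hdΞ E M hdL]
  simp only [Pi.zero_apply, mul_zero, zero_mul, sum_const_zero, add_zero]
  simp only [one_mul]
  exact hBω i i'

/-- `d'(y,v'_i,z'_s) = 0`. [this work] -/
theorem tq5_e_yvz (i : Fin 4) (s : Fin 7)
    (hP0 : ∀ ψ, P ψ (Fin.castAdd 7 (0 : Fin 5)) = (Fin.append (Fin.cons (1) ((0 : Fin 4 → ZMod 2)) : Fin 5 → ZMod 2) ((0 : Fin 7 → ZMod 2)) : Fin (5 + 7) → ZMod 2) ψ)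
    (hPv : ∀ ψ (i : Fin 4), P ψ (Fin.castAdd 7 (Fin.succ i)) = (Fin.append (Fin.cons (β i) (BC i) : Fin 5 → ZMod 2) ((0 : Fin 7 → ZMod 2)) : Fin (5 + 7) → ZMod 2) ψ)
    (hPz : ∀ ψ (j : Fin 7), P ψ (Fin.natAdd 5 j) = (Fin.append (Fin.cons (ε j) ((0 : Fin 4 → ZMod 2)) : Fin 5 → ZMod 2) (RC j) : Fin (5 + 7) → ZMod 2) ψ) :
    (∑ ψ, ∑ α, ∑ β', P ψ (Fin.castAdd 7 (0 : Fin 5)) * P α (Fin.castAdd 7 (Fin.succ i)) * P β' (Fin.natAdd 5 s) * d ψ α β') =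
      0 := by
  simp only [hP0, hPv, hPz]
  rw [tq5_eval d hds hdc hdd hF hzzz a Ξ hdΞ E M hdL]
  simp only [Pi.zero_apply, mul_zero, zero_mul, sum_const_zero, add_zero]


/-- `d'(y,z'_s,z'_u) = 0`. [this work] -/
theorem tq5_e_yzz (s u : Fin 7)
    (hP0 : ∀ ψ, P ψ (Fin.castAdd 7 (0 : Fin 5)) = (Fin.append (Fin.cons (1) ((0 : Fin 4 → ZMod 2)) : Fin 5 → ZMod 2) ((0 : Fin 7 → ZMod 2)) : Fin (5 + 7) → ZMod 2) ψ)
    (hPz : ∀ ψ (j : Fin 7), P ψ (Fin.natAdd 5 j) = (Fin.append (Fin.cons (ε j) ((0 : Fin 4 → ZMod 2)) : Fin 5 → ZMod 2) (RC j) : Fin (5 + 7) → ZMod 2) ψ) :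
    (∑ ψ, ∑ α, ∑ β', P ψ (Fin.castAdd 7 (0 : Fin 5)) * P α (Fin.natAdd 5 s) * P β' (Fin.natAdd 5 u) * d ψ α β') =
      0 := by
  simp only [hP0, hPz]
  rw [tq5_eval d hds hdc hdd hF hzzz a Ξ hdΞ E M hdL]
  simp only [Pi.zero_apply, mul_zero, zero_mul, sum_const_zero, add_zero]


/-- `d'(z',z',z') = 0`. [this work] -/
theorem tq5_e_zzz (s u w : Fin 7)
    (hPz : ∀ ψ (j : Fin 7), P ψ (Fin.natAdd 5 j) = (Fin.append (Fin.cons (ε j) ((0 : Fin 4 → ZMod 2)) : Fin 5 → ZMod 2) (RC j) : Fin (5 + 7) → ZMod 2) ψ) :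
    (∑ ψ, ∑ α, ∑ β', P ψ (Fin.natAdd 5 s) * P α (Fin.natAdd 5 u) * P β' (Fin.natAdd 5 w) * d ψ α β') =
      0 := by
  simp only [hPz]
  rw [tq5_eval d hds hdc hdd hF hzzz a Ξ hdΞ E M hdL]
  simp only [Pi.zero_apply, mul_zero, zero_mul, sum_const_zero, add_zero]


/-- `d'(v'_i,z'_s,z'_u) = a(b_i) · (Rᵀ Ξ R)_{su}`. [this work] -/
theorem tq5_e_vzz (i : Fin 4) (s u : Fin 7)
    (hPv : ∀ ψ (i : Fin 4), P ψ (Fin.castAdd 7 (Fin.succ i)) = (Fin.append (Fin.cons (β i) (BC i) : Fin 5 → ZMod 2) ((0 : Fin 7 → ZMod 2)) : Fin (5 + 7) → ZMod 2) ψ)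
    (hPz : ∀ ψ (j : Fin 7), P ψ (Fin.natAdd 5 j) = (Fin.append (Fin.cons (ε j) ((0 : Fin 4 → ZMod 2)) : Fin 5 → ZMod 2) (RC j) : Fin (5 + 7) → ZMod 2) ψ)
    (hBa : ∀ i : Fin 4, (∑ t : Fin 4, a t * BC i t) = if i = 0 then 1 else 0) :
    (∑ ψ, ∑ α, ∑ β', P ψ (Fin.castAdd 7 (Fin.succ i)) * P α (Fin.natAdd 5 s) * P β' (Fin.natAdd 5 u) * d ψ α β') =
      (if i = 0 then (1 : ZMod 2) else 0) * (∑ m : Fin 7, ∑ m' : Fin 7, Ξ m m' * RC s m * RC u m') := by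
  simp only [hPv, hPz]
  rw [tq5_eval d hds hdc hdd hF hzzz a Ξ hdΞ E M hdL]
  simp only [Pi.zero_apply, mul_zero, zero_mul, sum_const_zero, add_zero, zero_add]
  rw [← hBa i, Finset.sum_mul]
  refine sum_congr rfl fun t _ => ?_
  rw [Finset.mul_sum]
  refine sum_congr rfl fun j _ => ?_
  rw [Finset.mul_sum]
  exact sum_congr rfl fun k _ => by ring

/-- `d'(v',v',v') = 0` (the `y`-shear `β` kills the pure `v`-block cubic). [this work] -/
theorem tq5_e_vvv (i i' i'' : Fin 4)
    (hPv : ∀ ψ (i : Fin 4), P ψ (Fin.castAdd 7 (Fin.succ i)) = (Fin.append (Fin.cons (β i) (BC i) : Fin 5 → ZMod 2) ((0 : Fin 7 → ZMod 2)) : Fin (5 + 7) → ZMod 2) ψ)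
    (hBω : ∀ i i' : Fin 4, (∑ t : Fin 4, ∑ t' : Fin 4, BC i t * BC i' t' * ((if (t = 0 ∧ t' = 1) ∨ (t = 1 ∧ t' = 0) then (1 : ZMod 2) else 0) + (if (t = 2 ∧ t' = 3) ∨ (t = 3 ∧ t' = 2) then (1 : ZMod 2) else 0))) = ((if (i = 0 ∧ i' = 1) ∨ (i = 1 ∧ i' = 0) then (1 : ZMod 2) else 0) + (if (i = 2 ∧ i' = 3) ∨ (i = 3 ∧ i' = 2) then (1 : ZMod 2) else 0)))
    (hβ : ∀ i i' i'' : Fin 4, (∑ t : Fin 4, ∑ t' : Fin 4, ∑ t'' : Fin 4, BC i t * BC i' t' * BC i'' t'' * d (Fin.castAdd 7 (Fin.succ t)) (Fin.castAdd 7 (Fin.succ t')) (Fin.castAdd 7 (Fin.succ t''))) + β i * ((if (i' = 0 ∧ i'' = 1) ∨ (i' = 1 ∧ i'' = 0) then (1 : ZMod 2) else 0) + (if (i' = 2 ∧ i'' = 3) ∨ (i' = 3 ∧ i'' = 2) then (1 : ZMod 2) else 0)) + β i' * ((if (i = 0 ∧ i'' = 1) ∨ (i = 1 ∧ i'' = 0)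 then (1 : ZMod 2) else 0) + (if (i = 2 ∧ i'' = 3) ∨ (i = 3 ∧ i'' = 2) then (1 : ZMod 2) else 0)) + β i'' * ((if (i = 0 ∧ i' = 1) ∨ (i = 1 ∧ i' = 0) then (1 : ZMod 2) else 0) + (if (i = 2 ∧ i' = 3) ∨ (i = 3 ∧ i' = 2) then (1 : ZMod 2) else 0)) = 0) :
    (∑ ψ, ∑ α, ∑ β', P ψ (Fin.castAdd 7 (Fin.succ i)) * P α (Fin.castAdd 7 (Fin.succ i')) * P β' (Fin.castAdd 7 (Fin.succ i'')) * d ψ α β') =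
      0 := by
  simp only [hPv]
  rw [tq5_eval d hds hdc hdd hF hzzz a Ξ hdΞ E M hdL]
  simp only [Pi.zero_apply, mul_zero, zero_mul, sum_const_zero, add_zero]
  have e1 : (∑ t : Fin 4, ∑ t' : Fin 4, β i * BC i' t * BC i'' t' * ((if (t = 0 ∧ t' = 1) ∨ (t = 1 ∧ t' = 0) then (1 : ZMod 2) else 0) + (if (t = 2 ∧ t' = 3) ∨ (t = 3 ∧ t' = 2) then (1 : ZMod 2) else 0))) = β i * ((if (i' = 0 ∧ i'' = 1) ∨ (i' = 1 ∧ i'' = 0) then (1 : ZMod 2) else 0) + (if (i' = 2 ∧ i'' = 3) ∨ (i' = 3 ∧ i'' = 2) then (1 : ZMod 2) else 0)) := by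
    rw [← hBω i' i'', Finset.mul_sum]
    refine sum_congr rfl fun t _ => ?_
    rw [Finset.mul_sum]
    exact sum_congr rfl fun t' _ => by ring
  have e2 : (∑ t : Fin 4, ∑ t' : Fin 4, BC i t * β i' * BC i'' t' * ((if (t = 0 ∧ t' = 1) ∨ (t = 1 ∧ t' = 0) then (1 : ZMod 2) else 0) + (if (t = 2 ∧ t' = 3) ∨ (t = 3 ∧ t' = 2) then (1 : ZMod 2) else 0))) = β i' * ((if (i = 0 ∧ i'' = 1) ∨ (i = 1 ∧ i'' = 0) then (1 : ZMod 2) else 0) + (if (i = 2 ∧ i'' = 3) ∨ (i = 3 ∧ i'' = 2) then (1 : ZMod 2) else 0)) := by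
    rw [← hBω i i'', Finset.mul_sum]
    refine sum_congr rfl fun t _ => ?_
    rw [Finset.mul_sum]
    exact sum_congr rfl fun t' _ => by ring
  have e3 : (∑ t : Fin 4, ∑ t' : Fin 4, BC i t * BC i' t' * β i'' * ((if (t = 0 ∧ t' = 1) ∨ (t = 1 ∧ t' = 0) then (1 : ZMod 2) else 0) + (if (t = 2 ∧ t' = 3) ∨ (t = 3 ∧ t' = 2) then (1 : ZMod 2) else 0))) = β i'' * ((if (i = 0 ∧ i' = 1) ∨ (i = 1 ∧ i' = 0) then (1 : ZMod 2) else 0) + (if (i = 2 ∧ i' = 3) ∨ (i = 3 ∧ i' = 2) then (1 : ZMod 2) else 0)) := by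
    rw [← hBω i i', Finset.mul_sum]
    refine sum_congr rfl fun t _ => ?_
    rw [Finset.mul_sum]
    exact sum_congr rfl fun t' _ => by ring
  have h := hβ i i' i''
  rw [e1, e2, e3]
  linear_combination h

/-- `d'(v'_i,v'_{i'},z'_s) = a(b_i) Y_{i'}(s) + a(b_{i'}) Y_i(s)` (the `y`-shear `ε` kills `E`). [this work] -/
theorem tq5_e_vvz (i i' : Fin 4) (s : Fin 7)
    (hPv : ∀ ψ (i : Fin 4), P ψ (Fin.castAdd 7 (Fin.succ i)) = (Fin.append (Fin.cons (β i) (BC i) : Fin 5 → ZMod 2) ((0 : Fin 7 → ZMod 2)) : Fin (5 + 7) → ZMod 2) ψ)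
    (hPz : ∀ ψ (j : Fin 7), P ψ (Fin.natAdd 5 j) = (Fin.append (Fin.cons (ε j) ((0 : Fin 4 → ZMod 2)) : Fin 5 → ZMod 2) (RC j) : Fin (5 + 7) → ZMod 2) ψ)
    (hBω : ∀ i i' : Fin 4, (∑ t : Fin 4, ∑ t' : Fin 4, BC i t * BC i' t' * ((if (t = 0 ∧ t' = 1) ∨ (t = 1 ∧ t' = 0) then (1 : ZMod 2) else 0) + (if (t = 2 ∧ t' = 3) ∨ (t = 3 ∧ t' = 2) then (1 : ZMod 2) else 0))) = ((if (i = 0 ∧ i' = 1) ∨ (i = 1 ∧ i' = 0) then (1 : ZMod 2) else 0) + (if (i = 2 ∧ i' = 3) ∨ (i = 3 ∧ i' = 2) then (1 : ZMod 2) else 0)))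
    (hBa : ∀ i : Fin 4, (∑ t : Fin 4, a t * BC i t) = if i = 0 then 1 else 0)
    (hε : ∀ s : Fin 7, (∑ j : Fin 7, E j * RC s j) = ε s) :
    (∑ ψ, ∑ α, ∑ β', P ψ (Fin.castAdd 7 (Fin.succ i)) * P α (Fin.castAdd 7 (Fin.succ i')) * P β' (Fin.natAdd 5 s) * d ψ α β') =
      (if i = 0 then (1 : ZMod 2) else 0) * (∑ q : Fin 4, ∑ r : Fin 7, M q r * BC i' q * RC s r) + (if i' = 0 then (1 : ZMod 2) else 0) * (∑ q : Fin 4, ∑ r : Fin 7, M q r * BC i q * RC s r) := by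
  simp only [hPv, hPz]
  rw [tq5_eval d hds hdc hdd hF hzzz a Ξ hdΞ E M hdL]
  simp only [Pi.zero_apply, mul_zero, zero_mul, sum_const_zero, add_zero, zero_add]
  have e3 : (∑ t : Fin 4, ∑ t' : Fin 4, BC i t * BC i' t' * ε s * ((if (t = 0 ∧ t' = 1) ∨ (t = 1 ∧ t' = 0) then (1 : ZMod 2) else 0) + (if (t = 2 ∧ t' = 3) ∨ (t = 3 ∧ t' = 2) then (1 : ZMod 2) else 0))) = ε s * ((if (i = 0 ∧ i' = 1) ∨ (i = 1 ∧ i' = 0) then (1 : ZMod 2) else 0) + (if (i = 2 ∧ i' = 3) ∨ (i = 3 ∧ i' = 2) then (1 : ZMod 2) else 0)) := by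
    rw [← hBω i i', Finset.mul_sum]
    refine sum_congr rfl fun t _ => ?_
    rw [Finset.mul_sum]
    exact sum_congr rfl fun t' _ => by ring
  have x1 : (∑ t : Fin 4, ∑ t' : Fin 4, BC i t * BC i' t' * ((if (t = 0 ∧ t' = 1) ∨ (t = 1 ∧ t' = 0) then (1 : ZMod 2) else 0) + (if (t = 2 ∧ t' = 3) ∨ (t = 3 ∧ t' = 2) then (1 : ZMod 2) else 0))) * (∑ j : Fin 7, E j * RC s j) =
      ∑ t : Fin 4, ∑ t' : Fin 4, ∑ j : Fin 7, BC i t * BC i' t' * RC s j * (((if (t = 0 ∧ t' = 1) ∨ (t = 1 ∧ t' = 0) then (1 : ZMod 2) else 0) + (if (t = 2 ∧ t' = 3) ∨ (t = 3 ∧ t' = 2) then (1 : ZMod 2) else 0)) * E j) := by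
    rw [Finset.sum_mul]
    refine sum_congr rfl fun t _ => ?_
    rw [Finset.sum_mul]
    refine sum_congr rfl fun t' _ => ?_
    rw [Finset.mul_sum]
    exact sum_congr rfl fun j _ => by ring
  have x2 : (∑ t : Fin 4, a t * BC i t) * (∑ q : Fin 4, ∑ r : Fin 7, M q r * BC i' q * RC s r) =
      ∑ t : Fin 4, ∑ t' : Fin 4, ∑ j : Fin 7, BC i t * BC i' t' * RC s j * (a t * M t' j) := by
    rw [Finset.sum_mul]
    refine sum_congr rfl fun t _ => ?_
    rw [Finset.mul_sum]
    refine sum_congr rfl fun t' _ => ?_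
    rw [Finset.mul_sum]
    exact sum_congr rfl fun j _ => by ring
  have x3 : (∑ t' : Fin 4, a t' * BC i' t') * (∑ q : Fin 4, ∑ r : Fin 7, M q r * BC i q * RC s r) =
      ∑ t : Fin 4, ∑ t' : Fin 4, ∑ j : Fin 7, BC i t * BC i' t' * RC s j * (a t' * M t j) := by
    rw [Finset.sum_mul]
    simp_rw [Finset.mul_sum]
    rw [Finset.sum_comm]
    exact sum_congr rfl fun t _ => sum_congr rfl fun t' _ => sum_congr rfl fun j _ => by ring
  have e5 : (∑ t : Fin 4, ∑ t' : Fin 4, ∑ j : Fin 7, BC i t * BC i' t' * RC s j * (((if (t = 0 ∧ t' = 1) ∨ (t = 1 ∧ t' = 0) then (1 : ZMod 2) else 0) + (if (t = 2 ∧ t' = 3) ∨ (t = 3 ∧ t' = 2) then (1 : ZMod 2) else 0)) * E j + a t * M t' j + a t' * M t j)) =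
      (∑ t : Fin 4, ∑ t' : Fin 4, BC i t * BC i' t' * ((if (t = 0 ∧ t' = 1) ∨ (t = 1 ∧ t' = 0) then (1 : ZMod 2) else 0) + (if (t = 2 ∧ t' = 3) ∨ (t = 3 ∧ t' = 2) then (1 : ZMod 2) else 0))) * (∑ j : Fin 7, E j * RC s j) + (∑ t : Fin 4, a t * BC i t) * (∑ q : Fin 4, ∑ r : Fin 7, M q r * BC i' q * RC s r) +
        (∑ t' : Fin 4, a t' * BC i' t') * (∑ q : Fin 4, ∑ r : Fin 7, M q r * BC i q * RC s r) := by
    rw [x1, x2, x3, ← sum_add_distrib, ← sum_add_distrib]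
    refine sum_congr rfl fun t _ => ?_
    rw [← sum_add_distrib, ← sum_add_distrib]
    refine sum_congr rfl fun t' _ => ?_
    rw [← sum_add_distrib, ← sum_add_distrib]
    exact sum_congr rfl fun j _ => by ring
  rw [e3, e5, hBω, hε, hBa, hBa]
  have h2 : ε s * ((if (i = 0 ∧ i' = 1) ∨ (i = 1 ∧ i' = 0) then (1 : ZMod 2) else 0) + (if (i = 2 ∧ i' = 3) ∨ (i = 3 ∧ i' = 2) then (1 : ZMod 2) else 0)) + ((if (i = 0 ∧ i' = 1) ∨ (i = 1 ∧ i' = 0) then (1 : ZMod 2) else 0) + (if (i = 2 ∧ i' = 3) ∨ (i = 3 ∧ i' = 2) then (1 : ZMod 2) else 0)) * ε s = 0 := by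
    rw [mul_comm]; generalize ((if (i = 0 ∧ i' = 1) ∨ (i = 1 ∧ i' = 0) then (1 : ZMod 2) else 0) + (if (i = 2 ∧ i' = 3) ∨ (i = 3 ∧ i' = 2) then (1 : ZMod 2) else 0)) * ε s = x; revert x; decide
  linear_combination h2

end Frame

end Summit.QuantumAdvantage.QuantumAdvantage.Theorems.CubicForrelation.NearExactIsExact
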